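import Summits.QuantumFields.YangMills.Theorems.FluctuationComparisonRegPrIntLS2BetaStrataOfGaugedLetters
import HarnessLib

/-!
# S2β · strata residue of GAP♯∘ — THE DATUM-GAUGE WLOG FOR THE TWO GAUGED LETTERS: (D♮) and (F♮) of ✓p821904 with guard `G` ⟸ the SAME
# letters with a «good-gauge» guard `G′` + a gauge SUPPLIER `G V → ∃ u, G′(u•V)` — both letter bodies are invariant under re-gauging the
# DATUM `V ↦ u•V` together with the lifted transformation `û := liftTransfTo u` of the fine fields

Cell `ym3-torus` (YM ladder rung R3 = continuum `SU(2)` Yang–Mills on the three-torus — a RUNG: NOT d = 4, NOT infinite volume, NOT a mass gap,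
NOT Clay).  Width seat «width 12» `ym3-torus-px12` (gen 24), FREE px helper on crux `stmt-QuantumFields-20520`
(`Theses.UnitScaleTilt.FluctuationComparisonRegPrIntL`); `--kind proof --supports stmt-QuantumFields-20520 --as helper`, count-neutral, DEFINITION-FREE
(0 `def`, 0 `instance`, 0 `notation`, 0 `sorry`, default heartbeats).

WHY (located while docking the REL-TEL road, this seat's ✓∕⧗ `…S2BetaRelGaugeOfRelativeLetter` v2 + `…S2BetaLogChordComparison`).  The two-tower recursion
of (D♮) compares the `U`-tower with the background tower; BOTH equal the datum `V` at the top, and one level down both are comb-axial relative to the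
COMMON lift `lift(V)`.  Every quantity the recursion feeds on is RELATIVE and `V` cancels at the top — EXCEPT the chart letter (L♭) (log vs chord,
factor `1 + s_{j+1}²∕3`) and the lift-curvature junk of (F3)-rel (SIZE² × DIFF²) one level below the top, whose SIZE is the bond size of `lift(V)`'s
comb-axial neighbourhood: `≤ π∕L` on the combs (✓(W3)) plus the comb-loop holonomy of `lift(V)`, which is small only when `V`'s OWN bonds are
moderate in ITS gauge (✓p816227 (F3): the geodesic interpolation of far-apart, non-commuting bonds curves at rate `σ²`).  The letters of record
quantify over EVERY representative `V` of the datum's orbit (only `PlaqSmall` + the stratum guard `G`), so a discharger of (L♭) ∧ (H♭) needs `V` in a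
good gauge FIRST.  THIS FILE is that WLOG, as a door: the bodies of (D♮) and (F♮) are invariant under `(V, U₀, U) ↦ (u•V, û•U₀, û•U)` with
`û := liftTransfTo u` (`û↓ = u`, lit ✓`descTransf_liftTransfTo`): fibres are permuted (lit ✓`gaugeAct_mem_fibre_iff`), good histories, the action and
`minActionRegPr` are invariant (✓`gaugeAct_mem_histGood_iff`, ✓`wilsonAction4_gaugeAct`, lit ✓`minActionRegPr_gaugeAct`), the residual gauge is
CONJUGATED (`w := û⁻¹·w′·û`), `d²` and the relative plaquettes are invariant under a common transformation (✓`sum_dist1_sq_gaugeAct`, §1), and the pairing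
`LIN` is a combination of `reTr`'s by ✓`excess_eq` (§1 `inner_imVec_rel_gaugeAct_common` — no `Ad`-isometry lemma needed).
* §1 common-gauge identities; `mem_argmin_gaugeAct_liftTransfTo` (the argmin set over `V` is carried onto the argmin set over `u•V` by `û`).
* §2 ★★★ `relGaugeLetter_of_goodGauge (G G′) (hsupp) (hD′)` : ✓p821904's `hD` with guard `G`.
* §3 ★★★ `pairingLetter_of_goodGauge (G G′) (hsupp) (hF′)` : ✓p821904's `hF` with guard `G`.
The SUPPLIER `hsupp` is a displayed hypothesis in the letters' own prefix (`… ∃ γ₁ > 0, ∀ F γ …, ∀ J V, PlaqSmall … V → G F J V → ∃ u, G′ F J (u•V)`); its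
natural dischargers are the small-bond ∕ toron gauges of the tree (px19 g12's `RegPr ↦ toron gauge` series, UV3-NODE §30; lit `B4LandauGauge` class) —
NOT supplied here.  With `G′ := G ∧ «bonds of V ≤ σ₀»` the strata doors run unchanged (✓`gapStratum_of_gaugedLetters` takes any guard).

HONEST SCOPE.  Gauge-covariance plumbing over landed theorems; nothing is bounded here; `hsupp`, (D♮)_G′, (F♮)_G′ are HYPOTHESES; nothing of Bałaban's
analysis is asserted ([Balaban1985Variational] p.278 «The space 𝔘_k is gauge invariant», (3)–(4), Thm 1 p.279: the minimal orbit is an ORBIT;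
[Balaban1985Averaging] (11)–(13) p.19: covariance of the averaging); (D♮), (F♮), `hIrr`, `hA`, GAP♯∘ (`stub_uniformFibreGapOrbit`), S2β, crux 20520 and
`YM3TorusSU2` are NOT proved; no registered stub is closed; rung R3 = SU(2) YM₃ on T³ — NOT d = 4, NOT infinite volume, NOT a mass gap, NOT Clay; the
Yang–Mills mass gap is NOT proved.
-/

set_option autoImplicit false

noncomputable section

open Finset
open scoped Real RealInnerProductSpace
open Literature.MathematicalPhysics.QuantumLattice (su2Quat)
open Literature.MathematicalPhysics.QuantumFieldTheory.Balaban1983to89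
open Literature.MathematicalPhysics.QuantumFieldTheory.Balaban1983to89.T3ContinuumYM3Torus
open Literature.MathematicalPhysics.QuantumFieldTheory.Balaban1983to89.T3UnitLawDensityEML
open Literature.MathematicalPhysics.QuantumFieldTheory.Balaban1983to89.T3UnitScaleTilt
open Literature.MathematicalPhysics.QuantumFieldTheory.Balaban1983to89.T3TiltDescent
open Literature.MathematicalPhysics.QuantumFieldTheory.Balaban1983to89.T3LevelShift
open Literature.MathematicalPhysics.QuantumFieldTheory.Balaban1983to89.T3ConstrainedMinimiser (fibre)
open Literature.MathematicalPhysics.QuantumFieldTheory.Balaban1983to89.T3PrintedRegularMinimiser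
open Literature.MathematicalPhysics.QuantumFieldTheory.Balaban1983to89.T3PrintedRegularOrbits
open Literature.MathematicalPhysics.QuantumFieldTheory.Balaban1983to89.T4ExpWindowSmallField (imVec)
open Summit.QuantumFields.YangMills.Theorems.FluctuationComparisonRegPrIntLS2BetaResidualGauge
  (gaugeAct_mul_eq gaugeAct_inv_gaugeAct gaugeAct_mem_histGood_iff wilsonAction4_gaugeAct)
open Summit.QuantumFields.YangMills.Theorems.FluctuationComparisonRegPrIntLS2BetaOrbitDistComparison (sum_dist1_sq_gaugeAct)
open Summit.QuantumFields.YangMills.Theorems.FluctuationComparisonRegPrIntLS2BetaExcessSplit (excess_eq)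

namespace Summit.QuantumFields.YangMills.Theorems.FluctuationComparisonRegPrIntLS2BetaDatumGaugeWLOG

/-! ## §1 Common-gauge identities -/

section Common

variable {P : Params} {j : ℕ} {G : Type*} [GaugeGroup G]

/-- The relative plaquette of a COMMONLY re-gauged pair is the conjugate by `g(p₋)`:
`(plaqHol (g•A) p)⁻¹·plaqHol (g•B) p = g(p₋)·((plaqHol A p)⁻¹·plaqHol B p)·g(p₋)⁻¹`. [cite: Balaban1985Averaging, (8)-(9) p.19] -/
theorem rel_plaqHol_gaugeAct_common (g : Site P j → G) (A B : GaugeField P j G) (p : Plaq P j) :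
    (GaugeField.plaqHol (GaugeField.gaugeAct g A) p)⁻¹ * GaugeField.plaqHol (GaugeField.gaugeAct g B) p =
      g p.src * ((GaugeField.plaqHol A p)⁻¹ * GaugeField.plaqHol B p) * (g p.src)⁻¹ := by
  rw [T4WilsonGaugeFlatDirection.plaqHol_gaugeAct, T4WilsonGaugeFlatDirection.plaqHol_gaugeAct]
  group

/-- `reTr` of the relative plaquette is invariant under a common gauge transformation. [cite: Balaban1985Averaging, (8)-(9) p.19] -/
theorem reTr_rel_plaqHol_gaugeAct_common (g : Site P j → G) (A B : GaugeField P j G) (p : Plaq P j) :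
    reTr ((GaugeField.plaqHol (GaugeField.gaugeAct g A) p)⁻¹ * GaugeField.plaqHol (GaugeField.gaugeAct g B) p) =
      reTr ((GaugeField.plaqHol A p)⁻¹ * GaugeField.plaqHol B p) := by
  rw [rel_plaqHol_gaugeAct_common, GaugeGroup.reTr_conj]

/-- A gauge transformation `û` CONJUGATES gauge transformations: `û•((û⁻¹·w′·û)•X) = w′•(û•X)`. [cite: Balaban1985Averaging, (8) p.19] -/
theorem gaugeAct_gaugeAct_conj (û w' : Site P j → G) (X : GaugeField P j G) :
    GaugeField.gaugeAct û (GaugeField.gaugeAct (fun x => (û x)⁻¹ * (w' x * û x)) X) =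
      GaugeField.gaugeAct w' (GaugeField.gaugeAct û X) := by
  rw [← gaugeAct_mul_eq, ← gaugeAct_mul_eq]
  congr 1
  funext x
  simp only [Pi.mul_apply, mul_inv_cancel_left]

end Common

/-- The pairing term `⟪imVec q(P₀), imVec q(P₀⁻¹P)⟫` is a combination of `reTr`'s (✓`excess_eq`), hence invariant under a COMMON conjugation of the
two plaquettes — no `Ad`-isometry lemma needed. [folklore] -/
theorem inner_imVec_rel_gaugeAct_common {P : Params} {j : ℕ} (g : Site P j → Matrix.specialUnitaryGroup (Fin 2) ℂ)
    (A B : GaugeField P j (Matrix.specialUnitaryGroup (Fin 2) ℂ)) (p : Plaq P j) :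
    inner ℝ (imVec (su2Quat (GaugeField.plaqHol (GaugeField.gaugeAct g A) p)))
        (imVec (su2Quat ((GaugeField.plaqHol (GaugeField.gaugeAct g A) p)⁻¹ * GaugeField.plaqHol (GaugeField.gaugeAct g B) p))) =
      inner ℝ (imVec (su2Quat (GaugeField.plaqHol A p))) (imVec (su2Quat ((GaugeField.plaqHol A p)⁻¹ * GaugeField.plaqHol B p))) := by
  have h1 := excess_eq (GaugeField.plaqHol (GaugeField.gaugeAct g A) p) (GaugeField.plaqHol (GaugeField.gaugeAct g B) p)
  have h2 := excess_eq (GaugeField.plaqHol A p) (GaugeField.plaqHol B p)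
  rw [reTr_rel_plaqHol_gaugeAct_common, T4WilsonGaugeFlatDirection.plaqHol_gaugeAct, T4WilsonGaugeFlatDirection.plaqHol_gaugeAct,
    GaugeGroup.reTr_conj, GaugeGroup.reTr_conj] at h1
  rw [T4WilsonGaugeFlatDirection.plaqHol_gaugeAct, T4WilsonGaugeFlatDirection.plaqHol_gaugeAct]
  linarith

variable (F : T3Family) {J K : ℕ} (hJK : J ≤ K)

/-- **THE ARGMIN SET IS CARRIED ALONG**: if `U₀` minimises over the fibre of `V` (and is a good history), then `û•U₀` minimises over the fibre of `u•V`,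
`û := liftTransfTo u` (lit ✓`gaugeAct_mem_fibre_iff`, ✓`descTransf_liftTransfTo`, ✓`minActionRegPr_gaugeAct`; ✓`gaugeAct_mem_histGood_iff`,
✓`wilsonAction4_gaugeAct`). [cite: Balaban1985Variational, Thm 1 p.279, (3)-(4) p.278] -/
theorem mem_argmin_gaugeAct_liftTransfTo {θ : ℕ → ℝ} {ε₀ : ℝ} (hε : 0 ≤ ε₀) (u : GaugeTransf (F.P J) 0 (Matrix.specialUnitaryGroup (Fin 2) ℂ))
    (V : GaugeField (F.P J) 0 (Matrix.specialUnitaryGroup (Fin 2) ℂ)) {U₀ : GaugeField (F.P K) 0 (Matrix.specialUnitaryGroup (Fin 2) ℂ)}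
    (hU₀ : U₀ ∈ {U' : GaugeField (F.P K) 0 (Matrix.specialUnitaryGroup (Fin 2) ℂ) | U' ∈ fibre F ℰp J K hJK V ∧ U' ∈ histGood F ℰp θ K J ∧
      wilsonAction4 U' = minActionRegPr F J K hJK ε₀ V}) :
    GaugeField.gaugeAct (liftTransfTo F J K hJK u) U₀ ∈ {U' : GaugeField (F.P K) 0 (Matrix.specialUnitaryGroup (Fin 2) ℂ) |
      U' ∈ fibre F ℰp J K hJK (GaugeField.gaugeAct u V) ∧ U' ∈ histGood F ℰp θ K J ∧
      wilsonAction4 U' = minActionRegPr F J K hJK ε₀ (GaugeField.gaugeAct u V)} := by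
  obtain ⟨h1, h2, h3⟩ := hU₀
  refine ⟨?_, (gaugeAct_mem_histGood_iff F _ θ J U₀).mpr h2, ?_⟩
  · have h := (gaugeAct_mem_fibre_iff F hJK ℰp (liftTransfTo F J K hJK u) U₀ V).mpr h1
    rwa [descTransf_liftTransfTo] at h
  · rw [wilsonAction4_gaugeAct, minActionRegPr_gaugeAct F hJK hε, h3]

/-- Fibre membership is carried along: `U ∈ fibre(V) → û•U ∈ fibre(u•V)`. [cite: Balaban1985Variational, (3)-(4) p.278] -/
theorem mem_fibre_gaugeAct_liftTransfTo (u : GaugeTransf (F.P J) 0 (Matrix.specialUnitaryGroup (Fin 2) ℂ)) (V : GaugeField (F.P J) 0 (Matrix.specialUnitaryGroup (Fin 2) ℂ))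
    {U : GaugeField (F.P K) 0 (Matrix.specialUnitaryGroup (Fin 2) ℂ)} (hU : U ∈ fibre F ℰp J K hJK V) :
    GaugeField.gaugeAct (liftTransfTo F J K hJK u) U ∈ fibre F ℰp J K hJK (GaugeField.gaugeAct u V) := by
  have h := (gaugeAct_mem_fibre_iff F hJK ℰp (liftTransfTo F J K hJK u) U V).mpr hU
  rwa [descTransf_liftTransfTo] at h

/-- **THE RESIDUAL GAUGE IS CONJUGATED**: if `w′` is residual then so is `û⁻¹·w′·û`, `û := liftTransfTo u` (covariance of the descent
lit ✓`descendTo_gaugeAct`, `û↓ = u`). [cite: Balaban1985Variational, (4) p.278; Balaban1985Averaging, (11)-(13) p.19] -/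
theorem residual_conj_liftTransfTo (u : GaugeTransf (F.P J) 0 (Matrix.specialUnitaryGroup (Fin 2) ℂ)) {w' : Site (F.P K) 0 → (Matrix.specialUnitaryGroup (Fin 2) ℂ)}
    (hw' : ∀ X : GaugeField (F.P K) 0 (Matrix.specialUnitaryGroup (Fin 2) ℂ), descendTo F ℰp J K hJK (GaugeField.gaugeAct w' X) = descendTo F ℰp J K hJK X) :
    ∀ X : GaugeField (F.P K) 0 (Matrix.specialUnitaryGroup (Fin 2) ℂ),
      descendTo F ℰp J K hJK (GaugeField.gaugeAct (fun x => (liftTransfTo F J K hJK u x)⁻¹ * (w' x * liftTransfTo F J K hJK u x)) X) =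
        descendTo F ℰp J K hJK X := by
  intro X
  set û := liftTransfTo F J K hJK u with hû
  have hdesc : descTransf F J K hJK û = u := descTransf_liftTransfTo F J K hJK u
  -- `u • D(w•X) = D(û•(w•X)) = D(w′•(û•X)) = D(û•X) = u • D X`
  have h : GaugeField.gaugeAct u (descendTo F ℰp J K hJK (GaugeField.gaugeAct (fun x => (û x)⁻¹ * (w' x * û x)) X)) =
      GaugeField.gaugeAct u (descendTo F ℰp J K hJK X) := by
    rw [← hdesc, ← descendTo_gaugeAct, ← descendTo_gaugeAct, gaugeAct_gaugeAct_conj, hw']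
  have h2 := congrArg (GaugeField.gaugeAct (u⁻¹ : Site (F.P J) 0 → (Matrix.specialUnitaryGroup (Fin 2) ℂ))) h
  rwa [gaugeAct_inv_gaugeAct, gaugeAct_inv_gaugeAct] at h2

/-! ## §2 (D♮) with guard `G` from (D♮) with a good-gauge guard `G′` -/

/-- ★★★ **THE DATUM-GAUGE WLOG FOR (D♮)**: if every `G`-datum has a gauge representative satisfying `G′` (supplier `hsupp`, in the letter's prefix), and
the relative-gauge letter (D♮) holds with guard `G′`, then it holds with guard `G` — VERBATIM the `hD` hypothesis of ✓`gapStratum_of_gaugedLetters G`.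
Proof: move to `u•V` with `û := liftTransfTo u`, read (D♮)_G′ at `(û•U₀, û•U)`, conjugate the residual gauge back (`w := û⁻¹·w′·û`); `d²` and the
relative plaquettes are invariant under the common `û`. [cite: Balaban1985Variational, p.278 (sentence after (3)), (4) p.278, Thm 1 p.279] -/
theorem relGaugeLetter_of_goodGauge (G G' : (F : T3Family) → (J : ℕ) → GaugeField (F.P J) 0 (Matrix.specialUnitaryGroup (Fin 2) ℂ) → Prop)
    (hsupp : ∀ (L : ℕ), ∃ c₀ : ℝ, 0 < c₀ ∧ c₀ ≤ 1 ∧ ∀ (cw : ℝ), 0 < cw → cw ≤ c₀ → ∃ pS : ℝ, ∀ (b₀ p₀ : ℝ), 0 < b₀ → pS ≤ p₀ → 0 < p₀ →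
      ∃ γ₁ : ℝ, 0 < γ₁ ∧ ∀ (F : T3Family) (γ : ℝ), F.L = L → 0 < γ → γ ≤ γ₁ →
        ∀ (J : ℕ) (V : GaugeField (F.P J) 0 (Matrix.specialUnitaryGroup (Fin 2) ℂ)), PlaqSmall (θBal F.L γ (cw * b₀) p₀ J) V → G F J V →
          ∃ u : GaugeTransf (F.P J) 0 (Matrix.specialUnitaryGroup (Fin 2) ℂ), G' F J (GaugeField.gaugeAct u V))
    (hD' : ∀ (L : ℕ), ∃ c₀ : ℝ, 0 < c₀ ∧ c₀ ≤ 1 ∧ ∀ (cw : ℝ), 0 < cw → cw ≤ c₀ → ∃ pS : ℝ, ∀ (b₀ p₀ : ℝ), 0 < b₀ → pS ≤ p₀ → 0 < p₀ → ∃ ε₁ : ℝ, 0 < ε₁ ∧ ∀ (ε₀ : ℝ), 0 < ε₀ → ε₀ ≤ ε₁ →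
    ∃ γ₁ : ℝ, 0 < γ₁ ∧ ∃ C_D : ℝ, 0 < C_D ∧ ∀ (F : T3Family) (γ : ℝ), F.L = L → 0 < γ → γ ≤ γ₁ →
      ∀ (J K : ℕ) (hJK : J ≤ K) (V : GaugeField (F.P J) 0 (Matrix.specialUnitaryGroup (Fin 2) ℂ)), PlaqSmall (θBal F.L γ (cw * b₀) p₀ J) V →
      G' F J V →
      ∀ U₀ ∈ {U' : GaugeField (F.P K) 0 (Matrix.specialUnitaryGroup (Fin 2) ℂ) | U' ∈ fibre F ℰp J K hJK V ∧ U' ∈ histGood F ℰp (θBal F.L γ b₀ p₀) K J ∧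
          wilsonAction4 U' = minActionRegPr F J K hJK ε₀ V},
      ∀ U ∈ fibre F ℰp J K hJK V, U ∈ histGood F ℰp (θBal F.L γ b₀ p₀) K J →
        ∃ w : GaugeTransf (F.P K) 0 (Matrix.specialUnitaryGroup (Fin 2) ℂ),
          (∀ U' : GaugeField (F.P K) 0 (Matrix.specialUnitaryGroup (Fin 2) ℂ),
            descendTo F ℰp J K hJK (GaugeField.gaugeAct w U') = descendTo F ℰp J K hJK U') ∧
          ((F.L : ℝ)⁻¹) ^ (2 * (K - J)) * ∑ ℓ : PBond (F.P K) 0, dist1 (U ℓ * ((GaugeField.gaugeAct w U₀) ℓ)⁻¹) ^ 2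
            ≤ C_D * ∑ p : Plaq (F.P K) 0, (1 - reTr ((GaugeField.plaqHol (GaugeField.gaugeAct w U₀) p)⁻¹ * GaugeField.plaqHol U p))) :
    ∀ (L : ℕ), ∃ c₀ : ℝ, 0 < c₀ ∧ c₀ ≤ 1 ∧ ∀ (cw : ℝ), 0 < cw → cw ≤ c₀ → ∃ pS : ℝ, ∀ (b₀ p₀ : ℝ), 0 < b₀ → pS ≤ p₀ → 0 < p₀ → ∃ ε₁ : ℝ, 0 < ε₁ ∧ ∀ (ε₀ : ℝ), 0 < ε₀ → ε₀ ≤ ε₁ →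
    ∃ γ₁ : ℝ, 0 < γ₁ ∧ ∃ C_D : ℝ, 0 < C_D ∧ ∀ (F : T3Family) (γ : ℝ), F.L = L → 0 < γ → γ ≤ γ₁ →
      ∀ (J K : ℕ) (hJK : J ≤ K) (V : GaugeField (F.P J) 0 (Matrix.specialUnitaryGroup (Fin 2) ℂ)), PlaqSmall (θBal F.L γ (cw * b₀) p₀ J) V →
      G F J V →
      ∀ U₀ ∈ {U' : GaugeField (F.P K) 0 (Matrix.specialUnitaryGroup (Fin 2) ℂ) | U' ∈ fibre F ℰp J K hJK V ∧ U' ∈ histGood F ℰp (θBal F.L γ b₀ p₀) K J ∧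
          wilsonAction4 U' = minActionRegPr F J K hJK ε₀ V},
      ∀ U ∈ fibre F ℰp J K hJK V, U ∈ histGood F ℰp (θBal F.L γ b₀ p₀) K J →
        ∃ w : GaugeTransf (F.P K) 0 (Matrix.specialUnitaryGroup (Fin 2) ℂ),
          (∀ U' : GaugeField (F.P K) 0 (Matrix.specialUnitaryGroup (Fin 2) ℂ),
            descendTo F ℰp J K hJK (GaugeField.gaugeAct w U') = descendTo F ℰp J K hJK U') ∧
          ((F.L : ℝ)⁻¹) ^ (2 * (K - J)) * ∑ ℓ : PBond (F.P K) 0, dist1 (U ℓ * ((GaugeField.gaugeAct w U₀) ℓ)⁻¹) ^ 2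
            ≤ C_D * ∑ p : Plaq (F.P K) 0, (1 - reTr ((GaugeField.plaqHol (GaugeField.gaugeAct w U₀) p)⁻¹ * GaugeField.plaqHol U p)) := by
  intro L
  obtain ⟨c₁, hc₁, hc₁1, H1⟩ := hD' L
  obtain ⟨c₂, hc₂, -, H2⟩ := hsupp L
  refine ⟨min c₁ c₂, lt_min hc₁ hc₂, (min_le_left _ _).trans hc₁1, fun cw hcw hcwle => ?_⟩
  obtain ⟨pS₁, H1⟩ := H1 cw hcw (hcwle.trans (min_le_left _ _))
  obtain ⟨pS₂, H2⟩ := H2 cw hcw (hcwle.trans (min_le_right _ _))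
  refine ⟨max pS₁ pS₂, fun b₀ p₀ hb hpS hp => ?_⟩
  obtain ⟨ε₁, hε₁, H1⟩ := H1 b₀ p₀ hb ((le_max_left _ _).trans hpS) hp
  obtain ⟨γS, hγS, H2⟩ := H2 b₀ p₀ hb ((le_max_right _ _).trans hpS) hp
  refine ⟨ε₁, hε₁, fun ε₀ hε₀ hε₀le => ?_⟩
  obtain ⟨γD, hγD, C_D, hCD, H1⟩ := H1 ε₀ hε₀ hε₀le
  refine ⟨min γD γS, lt_min hγD hγS, C_D, hCD, fun F γ hFL hγ hγle J K hJK V hV hG U₀ hU₀ U hU hUg => ?_⟩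
  obtain ⟨u, hG'⟩ := H2 F γ hFL hγ (hγle.trans (min_le_right _ _)) J V hV hG
  set û := liftTransfTo F J K hJK u with hû
  have hV' : PlaqSmall (θBal F.L γ (cw * b₀) p₀ J) (GaugeField.gaugeAct u V) := (plaqSmall_gaugeAct_iff' _ u V).mpr hV
  obtain ⟨w', hw', hineq⟩ := H1 F γ hFL hγ (hγle.trans (min_le_left _ _)) J K hJK (GaugeField.gaugeAct u V) hV' hG'
    (GaugeField.gaugeAct û U₀) (mem_argmin_gaugeAct_liftTransfTo F hJK hε₀.le u V hU₀)
    (GaugeField.gaugeAct û U) (mem_fibre_gaugeAct_liftTransfTo F hJK u V hU) ((gaugeAct_mem_histGood_iff F û _ J U).mpr hUg)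
  refine ⟨fun x => (û x)⁻¹ * (w' x * û x), residual_conj_liftTransfTo F hJK u hw', ?_⟩
  have hd : ∑ ℓ : PBond (F.P K) 0, dist1 (U ℓ * ((GaugeField.gaugeAct (fun x => (û x)⁻¹ * (w' x * û x)) U₀) ℓ)⁻¹) ^ 2 =
      ∑ ℓ : PBond (F.P K) 0, dist1 ((GaugeField.gaugeAct û U) ℓ * ((GaugeField.gaugeAct w' (GaugeField.gaugeAct û U₀)) ℓ)⁻¹) ^ 2 := by
    rw [← sum_dist1_sq_gaugeAct û U, gaugeAct_gaugeAct_conj]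
  have hr : ∑ p : Plaq (F.P K) 0, (1 - reTr ((GaugeField.plaqHol (GaugeField.gaugeAct (fun x => (û x)⁻¹ * (w' x * û x)) U₀) p)⁻¹ *
        GaugeField.plaqHol U p)) =
      ∑ p : Plaq (F.P K) 0, (1 - reTr ((GaugeField.plaqHol (GaugeField.gaugeAct w' (GaugeField.gaugeAct û U₀)) p)⁻¹ *
        GaugeField.plaqHol (GaugeField.gaugeAct û U) p)) :=
    sum_congr rfl fun p _ => by rw [← gaugeAct_gaugeAct_conj û w' U₀, reTr_rel_plaqHol_gaugeAct_common]
  rw [hd, hr]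
  exact hineq

/-! ## §3 (F♮) with guard `G` from (F♮) with a good-gauge guard `G′` -/

/-- ★★★ **THE DATUM-GAUGE WLOG FOR (F♮)**: the pairing letter's body `−LIN(U;U₀) ≤ c·N⁻²·d²(U,U₀) + ¼·REL(U;U₀)` is invariant under the common `û`
(`LIN` is a combination of `reTr`'s, ✓`excess_eq`), so (F♮) with guard `G′` + the supplier gives (F♮) with guard `G` — VERBATIM the `hF` hypothesis of
✓`gapStratum_of_gaugedLetters G`. [cite: Balaban1985Variational, p.278 (sentence after (3)), Thm 1 p.279] -/
theorem pairingLetter_of_goodGauge (G G' : (F : T3Family) → (J : ℕ) → GaugeField (F.P J) 0 (Matrix.specialUnitaryGroup (Fin 2) ℂ) → Prop)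
    (hsupp : ∀ (L : ℕ), ∃ c₀ : ℝ, 0 < c₀ ∧ c₀ ≤ 1 ∧ ∀ (cw : ℝ), 0 < cw → cw ≤ c₀ → ∃ pS : ℝ, ∀ (b₀ p₀ : ℝ), 0 < b₀ → pS ≤ p₀ → 0 < p₀ →
      ∃ γ₁ : ℝ, 0 < γ₁ ∧ ∀ (F : T3Family) (γ : ℝ), F.L = L → 0 < γ → γ ≤ γ₁ →
        ∀ (J : ℕ) (V : GaugeField (F.P J) 0 (Matrix.specialUnitaryGroup (Fin 2) ℂ)), PlaqSmall (θBal F.L γ (cw * b₀) p₀ J) V → G F J V →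
          ∃ u : GaugeTransf (F.P J) 0 (Matrix.specialUnitaryGroup (Fin 2) ℂ), G' F J (GaugeField.gaugeAct u V))
    (hF' : ∀ (L : ℕ), ∃ c₀ : ℝ, 0 < c₀ ∧ c₀ ≤ 1 ∧ ∀ (cw : ℝ), 0 < cw → cw ≤ c₀ → ∃ pS : ℝ, ∀ (b₀ p₀ : ℝ), 0 < b₀ → pS ≤ p₀ → 0 < p₀ → ∃ ε₁ : ℝ, 0 < ε₁ ∧ ∀ (ε₀ : ℝ), 0 < ε₀ → ε₀ ≤ ε₁ →
    ∀ (c : ℝ), 0 < c → ∃ γ₁ : ℝ, 0 < γ₁ ∧ ∀ (F : T3Family) (γ : ℝ), F.L = L → 0 < γ → γ ≤ γ₁ →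
      ∀ (J K : ℕ) (hJK : J ≤ K) (V : GaugeField (F.P J) 0 (Matrix.specialUnitaryGroup (Fin 2) ℂ)), PlaqSmall (θBal F.L γ (cw * b₀) p₀ J) V →
      G' F J V →
      ∀ U₀ ∈ {U' : GaugeField (F.P K) 0 (Matrix.specialUnitaryGroup (Fin 2) ℂ) | U' ∈ fibre F ℰp J K hJK V ∧ U' ∈ histGood F ℰp (θBal F.L γ b₀ p₀) K J ∧
          wilsonAction4 U' = minActionRegPr F J K hJK ε₀ V},
      ∀ U ∈ fibre F ℰp J K hJK V, U ∈ histGood F ℰp (θBal F.L γ b₀ p₀) K J →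
        -(∑ p : Plaq (F.P K) 0,
            inner ℝ (imVec (su2Quat (GaugeField.plaqHol U₀ p))) (imVec (su2Quat ((GaugeField.plaqHol U₀ p)⁻¹ * GaugeField.plaqHol U p))))
          ≤ c * (((F.L : ℝ)⁻¹) ^ (2 * (K - J)) * ∑ ℓ : PBond (F.P K) 0, dist1 (U ℓ * (U₀ ℓ)⁻¹) ^ 2) +
            1 / 4 * ∑ p : Plaq (F.P K) 0, (1 - reTr ((GaugeField.plaqHol U₀ p)⁻¹ * GaugeField.plaqHol U p))) :
    ∀ (L : ℕ), ∃ c₀ : ℝ, 0 < c₀ ∧ c₀ ≤ 1 ∧ ∀ (cw : ℝ), 0 < cw → cw ≤ c₀ → ∃ pS : ℝ, ∀ (b₀ p₀ : ℝ), 0 < b₀ → pS ≤ p₀ → 0 < p₀ → ∃ ε₁ : ℝ, 0 < ε₁ ∧ ∀ (ε₀ : ℝ), 0 < ε₀ → ε₀ ≤ ε₁ →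
    ∀ (c : ℝ), 0 < c → ∃ γ₁ : ℝ, 0 < γ₁ ∧ ∀ (F : T3Family) (γ : ℝ), F.L = L → 0 < γ → γ ≤ γ₁ →
      ∀ (J K : ℕ) (hJK : J ≤ K) (V : GaugeField (F.P J) 0 (Matrix.specialUnitaryGroup (Fin 2) ℂ)), PlaqSmall (θBal F.L γ (cw * b₀) p₀ J) V →
      G F J V →
      ∀ U₀ ∈ {U' : GaugeField (F.P K) 0 (Matrix.specialUnitaryGroup (Fin 2) ℂ) | U' ∈ fibre F ℰp J K hJK V ∧ U' ∈ histGood F ℰp (θBal F.L γ b₀ p₀) K J ∧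
          wilsonAction4 U' = minActionRegPr F J K hJK ε₀ V},
      ∀ U ∈ fibre F ℰp J K hJK V, U ∈ histGood F ℰp (θBal F.L γ b₀ p₀) K J →
        -(∑ p : Plaq (F.P K) 0,
            inner ℝ (imVec (su2Quat (GaugeField.plaqHol U₀ p))) (imVec (su2Quat ((GaugeField.plaqHol U₀ p)⁻¹ * GaugeField.plaqHol U p))))
          ≤ c * (((F.L : ℝ)⁻¹) ^ (2 * (K - J)) * ∑ ℓ : PBond (F.P K) 0, dist1 (U ℓ * (U₀ ℓ)⁻¹) ^ 2) +
            1 / 4 * ∑ p : Plaq (F.P K) 0, (1 - reTr ((GaugeField.plaqHol U₀ p)⁻¹ * GaugeField.plaqHol U p)) := by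
  intro L
  obtain ⟨c₁, hc₁, hc₁1, H1⟩ := hF' L
  obtain ⟨c₂, hc₂, -, H2⟩ := hsupp L
  refine ⟨min c₁ c₂, lt_min hc₁ hc₂, (min_le_left _ _).trans hc₁1, fun cw hcw hcwle => ?_⟩
  obtain ⟨pS₁, H1⟩ := H1 cw hcw (hcwle.trans (min_le_left _ _))
  obtain ⟨pS₂, H2⟩ := H2 cw hcw (hcwle.trans (min_le_right _ _))
  refine ⟨max pS₁ pS₂, fun b₀ p₀ hb hpS hp => ?_⟩
  obtain ⟨ε₁, hε₁, H1⟩ := H1 b₀ p₀ hb ((le_max_left _ _).trans hpS) hp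
  obtain ⟨γS, hγS, H2⟩ := H2 b₀ p₀ hb ((le_max_right _ _).trans hpS) hp
  refine ⟨ε₁, hε₁, fun ε₀ hε₀ hε₀le c hc => ?_⟩
  obtain ⟨γF, hγF, H1⟩ := H1 ε₀ hε₀ hε₀le c hc
  refine ⟨min γF γS, lt_min hγF hγS, fun F γ hFL hγ hγle J K hJK V hV hG U₀ hU₀ U hU hUg => ?_⟩
  obtain ⟨u, hG'⟩ := H2 F γ hFL hγ (hγle.trans (min_le_right _ _)) J V hV hG
  set û := liftTransfTo F J K hJK u with hû
  have hV' : PlaqSmall (θBal F.L γ (cw * b₀) p₀ J) (GaugeField.gaugeAct u V) := (plaqSmall_gaugeAct_iff' _ u V).mpr hV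
  have h := H1 F γ hFL hγ (hγle.trans (min_le_left _ _)) J K hJK (GaugeField.gaugeAct u V) hV' hG'
    (GaugeField.gaugeAct û U₀) (mem_argmin_gaugeAct_liftTransfTo F hJK hε₀.le u V hU₀)
    (GaugeField.gaugeAct û U) (mem_fibre_gaugeAct_liftTransfTo F hJK u V hU) ((gaugeAct_mem_histGood_iff F û _ J U).mpr hUg)
  simp only [inner_imVec_rel_gaugeAct_common, reTr_rel_plaqHol_gaugeAct_common, sum_dist1_sq_gaugeAct] at h
  exact h

end Summit.QuantumFields.YangMills.Theorems.FluctuationComparisonRegPrIntLS2BetaDatumGaugeWLOG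

end
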